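import Literature.IUT.HodgeTheaters.PMBaseBridgePropsProofs
import Literature.IUT.HodgeTheaters.PMBaseDischarge
import Mathlib.CategoryTheory.Conj

/-!
# [IUTchI] Def 6.4 (iii): stability of the bridge poly-morphisms of a `𝒟-Θ^{±ell}`-Hodge theater (proofs only)

Mochizuki, *Inter-universal Teichmüller Theory I*, kurims manuscript (May 2020), §6: Def 6.1 (iv)(v)
pp. 157–158, Example 6.2 (i) p. 160, Example 6.3 (i) p. 161, Def 6.4 (i)–(iii) pp. 162–163
([IUTchI] Def 6.4 (iii) p.163) [claim: Mochizuki2012, status: disputed]. PROOF-ONLY companion (theorems, no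
definitions) to abc-iut-L5-t4's `PMBaseBridges.lean` (`PMBaseKit.DThetaPMEllHT`), written by the consumer seat
abc-iut-L6-t3 ([IUTchIII] §1) for the merge bridge plan/L6/MERGE-MAP.md §8 B10 part 2 (`StripFrame.ofKits`).

What is proved here, for an arbitrary `𝒟-Θ^{±ell}`-Hodge theater `†ℋ𝒯^{𝒟-Θ±ell} = (†𝔇_≻ ← †𝔇_T → †𝒟^{⊚±})` over
the interface `PMBaseKit`, from its field `exists_model` ("an isomorph of the model of Examples 6.2, 6.3")
and the discharged lemmas of `PMBaseModelsProofs` / `PMBaseBridgePropsProofs` / `PMBaseDischarge`: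

* `Aut_csp(−)` of a global object is stable under conjugation by isomorphisms of global objects
  (`autCsp_conjAut_mem`; functoriality of `LabCusp^±(†𝒟^{⊚±})`, Def 6.1 (v)(vi)), and consequently the
  `Aut_csp`-orbits of isomorphisms compose (`exists_autCsp_trans_eq`);
* every `†φ^{Θ±}_t : †𝔇_t → †𝔇_≻` is a `+`-full poly-isomorphism (`DThetaPMEllHT.exists_polyPM_eq`, Def 6.4 (i)
  via Ex 6.2 (i)), hence is unchanged by pre-composition with the positive `+`-full poly-automorphism of
  `†𝔇_t` and by post-composition with that of `†𝔇_≻` (`polyComp_positive_polyPM`, `polyComp_polyPM_positive`);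
* every `†φ^{Θell}_{v_t} : †𝒟_{v_t} → †𝒟^{⊚±}` is stable under pre-composition with `Aut_+(†𝒟_{v_t})` and under
  post-composition with `Aut_csp(†𝒟^{⊚±})` (`polyEll_pre_mem`, `polyEll_post_mem`, Ex 6.3 (i) "the
  poly-morphism given by the collection of morphisms `β ∘ φ^{Θell}_{•,v} ∘ α`, where `α ∈ Aut_+(𝒟_{v_0})`,
  `β ∈ Aut_csp(𝒟^{⊚±})`"), which is recorded as the set identity `ellCompat_refl`.

These are exactly the facts that make the IDENTITY (index bijection `id`, identity isomorphisms at every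
constituent) satisfy the printed compatibility conditions of an isomorphism of `𝒟-Θ^{±ell}`-Hodge theaters
(Def 6.4 (i) "compatible with `†φ^{Θ±}_±`, `‡φ^{Θ±}_±`"; (ii) "compatible with `†φ^{Θell}_±`, `‡φ^{Θell}_±`"), i.e.
that isomorphisms of `𝒟-Θ^{±ell}`-Hodge theaters form a groupoid with the evident identity — used by the
representative-level groupoid of [IUTchIII] §1's frame (abc-iut-L6-t3, `DHodgeTheaterGroupoid.lean`).
HONEST FRAMING: elementary consequences of abc-iut-L5-t4's typed definitions; nothing here bears on
[IUTchIII] Cor 3.12; typed ≠ discharged for the series' claims.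
-/

namespace Literature.IUT.HodgeTheaters

open CategoryTheory

universe u

namespace PMBaseKit

variable {l : ℕ} {K : PMBaseKit.{u} l}

/-! ### `Aut_csp` is stable under conjugation -/

/-- **IUTchI:Def6.1(v)** (kurims p.158) Functoriality of `LabCusp^±(†𝒟^{⊚±})`: the bijection induced by the inverse of an
isomorphism of global objects is the inverse bijection. ([IUTchI] Def 6.1 (vi) p.159) [claim: Mochizuki2012, status: disputed] -/
theorem gLabMap_symm {G H : K.Glob} (ψ : G ≅ H) : K.gLabMap ψ.symm = (K.gLabMap ψ).symm := by
  have h := K.gLabMap_trans ψ ψ.symm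
  rw [Iso.self_symm_id, K.gLabMap_refl] at h
  ext x
  have hx := congrArg (fun e => e ((K.gLabMap ψ).symm x)) h
  simp only [Equiv.refl_apply, Equiv.trans_apply, Equiv.apply_symm_apply] at hx
  exact hx.symm

/-- **IUTchI:Def6.1(v)** (kurims p.158) `Aut_csp(−)` ("the subgroup … of automorphisms that fix the cusps") is carried onto
`Aut_csp(−)` by conjugation `c ↦ ψ⁻¹ ∘ c ∘ ψ` (Mathlib `Iso.conjAut`) along any isomorphism of global objects
`ψ : †𝒟^{⊚±} ⥲ ‡𝒟^{⊚±}` (functoriality of `LabCusp^±`, Def 6.1 (vi)). ([IUTchI] Def 6.1 (v) p.158) [claim: Mochizuki2012, status: disputed] -/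
theorem autCsp_conjAut_mem {G H : K.Glob} (ψ : G ≅ H) {c : Aut G} (hc : c ∈ K.autCsp G) :
    ψ.conjAut c ∈ K.autCsp H := by
  have hc' : K.gLabMap c = Equiv.refl _ := MonoidHom.mem_ker.mp hc
  refine MonoidHom.mem_ker.mpr ?_
  show K.gLabMap (ψ.conjAut c) = Equiv.refl _
  rw [Iso.conjAut_apply, K.gLabMap_trans, K.gLabMap_trans, hc', Equiv.refl_trans, gLabMap_symm,
    Equiv.symm_trans_self]

/-- **IUTchI:Def6.4(ii)** (kurims p.163) The `Aut_csp(‡𝒟^{⊚±})`-orbits of isomorphisms of global objects ("a poly-morphism which is an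
`Aut_csp(†𝒟^{⊚±})`- [or, equivalently, `Aut_csp(‡𝒟^{⊚±})`-] orbit of isomorphisms") COMPOSE: a member of the orbit
of `g₁` followed by a member of the orbit of `g₂` is a member of the orbit of `g₁ ≫ g₂`.
([IUTchI] Def 6.4 (ii) p.163) [claim: Mochizuki2012, status: disputed] -/
theorem exists_autCsp_trans_eq {G₁ G₂ G₃ : K.Glob} (g₁ : G₁ ≅ G₂) (g₂ : G₂ ≅ G₃)
    {c₁ : Aut G₂} (hc₁ : c₁ ∈ K.autCsp G₂) {c₂ : Aut G₃} (hc₂ : c₂ ∈ K.autCsp G₃) :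
    ∃ c ∈ K.autCsp G₃, (g₁ ≪≫ c₁) ≪≫ (g₂ ≪≫ c₂) = (g₁ ≪≫ g₂) ≪≫ c := by
  refine ⟨c₂ * g₂.conjAut c₁, (K.autCsp G₃).mul_mem hc₂ (autCsp_conjAut_mem g₂ hc₁), ?_⟩
  rw [Aut.Aut_mul_def, Iso.conjAut_apply]
  simp only [Iso.trans_assoc, Iso.self_symm_id_assoc]

/-- **IUTchI:Def6.1(iii)** (kurims p.157) `Aut_+(−)` ("the subgroup of positive automorphisms") is carried onto `Aut_+(−)` by
conjugation `a ↦ φ⁻¹ ∘ a ∘ φ` (Mathlib `Iso.conjAut`) along any isomorphism `φ : †𝒟_v ⥲ ‡𝒟_v` (functoriality of `LabCusp^±(−)`, "constructed solely from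
`†𝒟_v`", Def 6.1 (iii) p.156). ([IUTchI] Def 6.1 (iii) p.157) [claim: Mochizuki2012, status: disputed] -/
theorem autPlus_conjAut_mem {v : K.V} {X Y : K.Amb v} (φ : X ≅ Y) {a : Aut X} (ha : a ∈ K.autPlus v X) :
    φ.conjAut a ∈ K.autPlus v Y := by
  have ha' : K.labMap v a = Equiv.refl _ := (K.mem_autPlus_iff a).mp ha
  refine (K.mem_autPlus_iff (φ.conjAut a)).mpr ?_
  rw [Iso.conjAut_apply]
  exact (labMap_conj_eq_refl_iff φ a).mpr ha'

/-! ### The bridge poly-morphisms of a `𝒟-Θ^{±ell}`-Hodge theater -/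

namespace DThetaPMEllHT

variable (H : K.DThetaPMEllHT)

/-- **IUTchI:Def6.4(iii)** (kurims p.163) Every `†φ^{Θ±}_t : †𝔇_t → †𝔇_≻` of a `𝒟-Θ^{±ell}`-Hodge theater is a `+`-full
poly-isomorphism — the orbit of a single isomorphism `θ_t : †𝔇_t ⥲ †𝔇_≻` (Def 6.4 (i) via Example 6.2 (i) "the
respective positive `+`-full poly-isomorphisms"). ([IUTchI] Def 6.4 (i) p.162) [claim: Mochizuki2012, status: disputed] -/
theorem exists_polyPM_eq :
    ∃ θ : ∀ t, (H.capsule t).Iso H.codomain, ∀ t, H.polyPM t = DStrip.plusFullPolyIso (θ t) :=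
  H.pmBridge.exists_poly_eq

/-- **IUTchI:Def6.4(iii)** (kurims p.163) `†φ^{Θ±}_t` is unchanged by pre-composition with the positive `+`-full
poly-automorphism `Aut_+(†𝔇_t)` of its domain (Def 6.1 (iv) "the `+`-full poly-isomorphism determined by the
identity isomorphism, which we shall refer to as positive"). ([IUTchI] Def 6.4 (i) p.162) [claim: Mochizuki2012, status: disputed] -/
theorem polyComp_positive_polyPM (t : H.T) :
    DStrip.polyComp (DStrip.plusFullPolyIso (DStrip.Iso.refl (H.capsule t))) (H.polyPM t) = H.polyPM t := by
  obtain ⟨θ, hθ⟩ := H.exists_polyPM_eq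
  rw [hθ t, DStrip.polyComp_plusFullPolyIso]
  congr 1
  funext v
  exact Iso.refl_trans (θ t v)

/-- **IUTchI:Def6.4(iii)** (kurims p.163) `†φ^{Θ±}_t` is unchanged by post-composition with the positive `+`-full
poly-automorphism `Aut_+(†𝔇_≻)` of its codomain. ([IUTchI] Def 6.4 (i) p.162) [claim: Mochizuki2012, status: disputed] -/
theorem polyComp_polyPM_positive (t : H.T) :
    DStrip.polyComp (H.polyPM t) (DStrip.plusFullPolyIso (DStrip.Iso.refl H.codomain)) = H.polyPM t := by
  obtain ⟨θ, hθ⟩ := H.exists_polyPM_eq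
  rw [hθ t, DStrip.polyComp_plusFullPolyIso]
  congr 1
  funext v
  exact Iso.trans_refl (θ t v)

/-- **IUTchI:Def6.4(iii)** (kurims p.163) `†φ^{Θell}_{v_t}` is stable under PRE-composition with positive automorphisms of
`†𝒟_{v_t}` (Example 6.3 (i) p.161: "the collection of morphisms `β ∘ φ^{Θell}_{•,v} ∘ α`, where `α ∈ Aut_+(𝒟_{v_0})`",
transported by `exists_model`). ([IUTchI] Def 6.4 (ii) p.163) [claim: Mochizuki2012, status: disputed] -/
theorem polyEll_pre_mem {t : H.T} {v : K.V} {p : (H.capsule t).obj v ≅ (H.capsule t).obj v}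
    (hp : K.labMap v p = Equiv.refl _) {h : (H.capsule t).obj v ⟶ (K.atV v).obj H.glob}
    (hh : h ∈ H.polyEll t v) : p.hom ≫ h ∈ H.polyEll t v := by
  obtain ⟨ι, -, α, -, γ, -, hEll⟩ := H.exists_model
  obtain ⟨z, rfl⟩ := ι.surjective t
  rw [hEll] at hh ⊢
  exact ellConj_pre_mem (α z) γ z hp hh

/-- **IUTchI:Def6.4(iii)** (kurims p.163) `†φ^{Θell}_{v_t}` is stable under POST-composition with (the image at `v` of) an
automorphism of `†𝒟^{⊚±}` fixing the cusps (Example 6.3 (i) p.161: "… where … `β ∈ Aut_csp(𝒟^{⊚±})`", transported by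
`exists_model`). ([IUTchI] Def 6.4 (ii) p.163) [claim: Mochizuki2012, status: disputed] -/
theorem polyEll_post_mem {t : H.T} {v : K.V} {c : H.glob ≅ H.glob} (hc : K.gLabMap c = Equiv.refl _)
    {h : (H.capsule t).obj v ⟶ (K.atV v).obj H.glob} (hh : h ∈ H.polyEll t v) :
    h ≫ (K.atV v).map c.hom ∈ H.polyEll t v := by
  obtain ⟨ι, -, α, -, γ, -, hEll⟩ := H.exists_model
  obtain ⟨z, rfl⟩ := ι.surjective t
  rw [hEll] at hh ⊢
  exact ellConj_post_mem (α z) γ z hc hh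

/-- **IUTchI:Def6.4(iii)** (kurims p.163) The identity satisfies the compatibility condition of Def 6.4 (ii) ("compatible with
`†φ^{Θell}_±`, `‡φ^{Θell}_±`") with respect to `†φ^{Θell}_±` on both sides: composing the positive `+`-full
poly-automorphism of `†𝔇_t` with `†φ^{Θell}_{v_t}` gives the same poly-morphism as composing `†φ^{Θell}_{v_t}` with the
`Aut_csp(†𝒟^{⊚±})`-orbit of the identity of `†𝒟^{⊚±}`. ([IUTchI] Def 6.4 (ii) p.163) [claim: Mochizuki2012, status: disputed] -/
theorem ellCompat_refl (t : H.T) (v : K.V) :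
    {h | ∃ p ∈ DStrip.plusFullPolyIso (DStrip.Iso.refl (H.capsule t)), ∃ g ∈ H.polyEll t v, h = (p v).hom ≫ g} =
      {h | ∃ f ∈ H.polyEll t v, ∃ c ∈ K.autCsp H.glob,
        h = f ≫ (K.atV v).map (Iso.refl H.glob ≪≫ c).hom} := by
  ext h
  simp only [Set.mem_setOf_eq]
  constructor
  · rintro ⟨p, hp, g, hg, rfl⟩
    have hpv : K.labMap v (p v) = Equiv.refl _ := by
      rw [(DStrip.mem_plusFullPolyIso_iff).mp hp v]
      exact K.labMap_refl v _
    refine ⟨(p v).hom ≫ g, H.polyEll_pre_mem hpv hg, 1, one_mem _, ?_⟩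
    change (p v).hom ≫ g = ((p v).hom ≫ g) ≫ (K.atV v).map (Iso.refl H.glob ≪≫ Iso.refl H.glob).hom
    simp
  · rintro ⟨f, hf, c, hc, rfl⟩
    have hc' : K.gLabMap c = Equiv.refl _ := MonoidHom.mem_ker.mp hc
    refine ⟨DStrip.Iso.refl (H.capsule t), DStrip.self_mem_plusFullPolyIso _, f ≫ (K.atV v).map c.hom,
      H.polyEll_post_mem hc' hf, ?_⟩
    change f ≫ (K.atV v).map (Iso.refl H.glob ≪≫ c).hom = (Iso.refl ((H.capsule t).obj v)).hom ≫ _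
    simp only [Iso.refl_trans, Iso.refl_hom, Category.id_comp]

end DThetaPMEllHT

end PMBaseKit

end Literature.IUT.HodgeTheaters
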